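import Mathlib

/-!
# Crux `NearExtremalTransiencePerFlow` (stmt-NavierStokesRegularity-26567), LINE g12-β `depleted_fraction`:
# the CLEAN-POINT lemma behind stub W♭ `stub_cleanLockedWindow` (pure real analysis)

Helper file (lands `--supports stmt-NavierStokesRegularity-26567`) for the by-text stub `stub_cleanLockedWindow : CleanLockedWindow`
of the files-only skeleton `Cruxes/NearExtremalTransiencePerFlow/Lines/depleted_fraction.lean` (ns-idea-5 g12, commit 2f495cb0319b);
the flow-side stub itself is `…Theorems.ExtremiserTransienceDepletedFractionCleanLockedWindow` (imports this file).

THE CLEAN POINT (`exists_clean_point`).  `S, F ⊆ ℝ` measurable, `t₁ ≤ t < T`, `0 < a ≤ 1/2`, `η > 0`, log-weights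
`Λ(A) = ∫_{t₁}^{t} 1_A(τ) dτ/(T−τ)`.  If `2Λ(F) + 2 < ηΛ(S)` then some `τ ∈ S` has an `η`-CLEAN forward window:
`|F ∩ [τ, τ + a(T−τ)]| ≤ η·a(T−τ)`.
Proof (a Tonelli count — no covering theorem, no logarithms).  If every `τ ∈ S ∩ (t₁,t]` were dirty, each would own
`F`-weight `∫_{F ∩ [τ, τ+a(T−τ)]} dt''/(T−t'') ≥ ηa` (`owned_weight_ge`); integrate against `dτ/(T−τ)` over `S ∩ (t₁,t]` and
swap the integrals; for fixed `t''` the admissible `τ` lie in `[T − (T−t'')/(1−a), t'']`, of `dτ/(T−τ)`-weight `≤ a/(1−a)`, and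
`t'' ∈ (t₁, T − (1−a)(T−t)]` (`admissible_weight_le`); the part of that range beyond `t` weighs `≤ a/(1−a)`
(`fwd_tail_weight_le`).  Hence `ηa·Λ(S) ≤ (a/(1−a))·(Λ(F) + a/(1−a))`, i.e. `ηΛ(S) ≤ 2Λ(F) + 2` for `a ≤ 1/2`.
Also: `∫_{t₁}^{t} dτ/(T−τ) = log((T−t₁)/(T−t))`.
HONEST FRAMING: lemmas about sets of reals and one weight; nothing about Navier–Stokes is proved here; no summit is proved by a
line. [folklore]
-/

noncomputable section

open Set MeasureTheory
open scoped ENNReal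

namespace Summit.NavierStokesRegularity.NavierStokesRegularity.Theorems.NearExtremalTransiencePerFlow.DepletedFraction

-- the summit's namespace repeats the problem name by convention (D-0017)
set_option linter.dupNamespace false

/-! ### The Tonelli count: a clean point exists -/

/-- The forward-window relation `{(τ,t'') : τ ≤ t'' ≤ τ + a(T−τ)}` is closed, hence measurable. [folklore] -/
theorem measurableSet_fwdRel (T a : ℝ) :
    MeasurableSet {q : ℝ × ℝ | q.1 ≤ q.2 ∧ q.2 ≤ q.1 + a * (T - q.1)} := by
  have h1 : IsClosed {q : ℝ × ℝ | q.1 ≤ q.2} := isClosed_le (by fun_prop) (by fun_prop)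
  have h2 : IsClosed {q : ℝ × ℝ | q.2 ≤ q.1 + a * (T - q.1)} := isClosed_le (by fun_prop) (by fun_prop)
  rw [setOf_and]
  exact (h1.inter h2).measurableSet

/-- Step A1: a DIRTY point `τ < T` (`|F ∩ [τ, τ + a(T−τ)]| ≥ ηa(T−τ)`) owns `F`-weight `≥ ηa` in its forward window.
[folklore] -/
theorem owned_weight_ge {T τ a η : ℝ} {F : Set ℝ} (ρ : ℝ → ℝ≥0∞) (hρ : ∀ σ, ρ σ = ENNReal.ofReal (1 / (T - σ)))
    (P : Set (ℝ × ℝ)) (hP : ∀ q : ℝ × ℝ, q ∈ P ↔ q.1 ≤ q.2 ∧ q.2 ≤ q.1 + a * (T - q.1))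
    (hF : MeasurableSet F) (hτ : τ < T) (ha1 : a < 1)
    (hdirty : ENNReal.ofReal (η * (a * (T - τ))) ≤ volume (F ∩ Icc τ (τ + a * (T - τ)))) :
    ENNReal.ofReal (η * a) ≤ ∫⁻ t'' in F, P.indicator (fun _ => (1 : ℝ≥0∞)) (τ, t'') * ρ t'' := by
  have hTτ : 0 < T - τ := sub_pos.2 hτ
  have hw : 0 ≤ 1 / (T - τ) := div_nonneg zero_le_one hTτ.le
  calc ENNReal.ofReal (η * a) = ENNReal.ofReal (1 / (T - τ)) * ENNReal.ofReal (η * (a * (T - τ))) := by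
        rw [← ENNReal.ofReal_mul hw]
        congr 1
        field_simp
    _ ≤ ENNReal.ofReal (1 / (T - τ)) * volume (F ∩ Icc τ (τ + a * (T - τ))) :=
        mul_le_mul_of_nonneg_left hdirty bot_le
    _ = ∫⁻ _ in F ∩ Icc τ (τ + a * (T - τ)), ENNReal.ofReal (1 / (T - τ)) := (setLIntegral_const _ _).symm
    _ ≤ ∫⁻ t'' in F ∩ Icc τ (τ + a * (T - τ)), P.indicator (fun _ => (1 : ℝ≥0∞)) (τ, t'') * ρ t'' := by
        refine setLIntegral_mono' (hF.inter measurableSet_Icc) fun t'' ht'' => ?_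
        have hmem : (τ, t'') ∈ P := by
          rw [hP]
          exact ⟨ht''.2.1, ht''.2.2⟩
        rw [indicator_of_mem hmem, one_mul, hρ]
        refine ENNReal.ofReal_le_ofReal ?_
        have h1a : 0 < 1 - a := by linarith
        have h₃ : 0 < (1 - a) * (T - τ) := mul_pos h1a hTτ
        have h₄ : (1 - a) * (T - τ) = (T - τ) - a * (T - τ) := by ring
        have hpos : 0 < T - t'' := by linarith [ht''.2.2]
        have hle : T - t'' ≤ T - τ := by linarith [ht''.2.1]
        exact one_div_le_one_div_of_le hpos hle
    _ ≤ ∫⁻ t'' in F, P.indicator (fun _ => (1 : ℝ≥0∞)) (τ, t'') * ρ t'' := lintegral_mono_set inter_subset_left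

/-- Step A3: for fixed `t''`, the `ρ`-weight of the points `τ ∈ S ⊆ (t₁,t]` whose forward window contains `t''` is at most
`a/(1−a)`, and it vanishes unless `t₁ < t'' ≤ T − (1−a)(T−t)`. [folklore] -/
theorem admissible_weight_le {T t₁ t t'' a : ℝ} {S : Set ℝ} (ρ : ℝ → ℝ≥0∞)
    (hρ : ∀ σ, ρ σ = ENNReal.ofReal (1 / (T - σ))) (P : Set (ℝ × ℝ))
    (hP : ∀ q : ℝ × ℝ, q ∈ P ↔ q.1 ≤ q.2 ∧ q.2 ≤ q.1 + a * (T - q.1))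
    (hS : MeasurableSet S) (hSsub : S ⊆ Ioc t₁ t) (htT : t < T) (ha1 : a < 1) :
    ∫⁻ τ in S, P.indicator (fun _ => (1 : ℝ≥0∞)) (τ, t'') * ρ τ ≤
      (Ioc t₁ (T - (1 - a) * (T - t))).indicator (fun _ => ENNReal.ofReal (a / (1 - a))) t'' := by
  have h1a : 0 < 1 - a := by linarith
  have hTt : 0 < T - t := sub_pos.2 htT
  by_cases hmem : t'' ∈ Ioc t₁ (T - (1 - a) * (T - t))
  · rw [indicator_of_mem hmem]
    have hTt'' : 0 < T - t'' := by
      have : 0 < (1 - a) * (T - t) := mul_pos h1a hTt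
      linarith [hmem.2]
    have hw : 0 ≤ 1 / (T - t'') := div_nonneg zero_le_one hTt''.le
    calc ∫⁻ τ in S, P.indicator (fun _ => (1 : ℝ≥0∞)) (τ, t'') * ρ τ
        ≤ ∫⁻ τ in S, (Icc (T - (T - t'') / (1 - a)) t'').indicator
            (fun _ => ENNReal.ofReal (1 / (T - t''))) τ := by
          refine setLIntegral_mono' hS fun τ hτ => ?_
          by_cases hK : (τ, t'') ∈ P
          · obtain ⟨hK1, hK2⟩ := (hP _).1 hK
            have hlo : T - τ ≤ (T - t'') / (1 - a) := by
              rw [le_div_iff₀ h1a]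
              nlinarith
            have hV : τ ∈ Icc (T - (T - t'') / (1 - a)) t'' := ⟨by linarith, hK1⟩
            rw [indicator_of_mem hK, one_mul, indicator_of_mem hV, hρ]
            exact ENNReal.ofReal_le_ofReal (one_div_le_one_div_of_le hTt'' (by linarith))
          · rw [indicator_of_notMem hK, zero_mul]
            exact bot_le
      _ ≤ ∫⁻ τ, (Icc (T - (T - t'') / (1 - a)) t'').indicator (fun _ => ENNReal.ofReal (1 / (T - t''))) τ :=
          setLIntegral_le_lintegral _ _
      _ = ENNReal.ofReal (1 / (T - t'')) * volume (Icc (T - (T - t'') / (1 - a)) t'') :=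
          lintegral_indicator_const measurableSet_Icc _
      _ = ENNReal.ofReal (a / (1 - a)) := by
          rw [Real.volume_Icc, ← ENNReal.ofReal_mul hw]
          congr 1
          field_simp
          ring
  · rw [indicator_of_notMem hmem]
    refine le_of_eq (setLIntegral_eq_zero hS fun τ hτ => ?_)
    have hτ₁ : t₁ < τ := (hSsub hτ).1
    have hτt : τ ≤ t := (hSsub hτ).2
    have hK : (τ, t'') ∉ P := by
      intro hK
      obtain ⟨hK1, hK2⟩ := (hP _).1 hK
      apply hmem
      constructor
      · linarith
      · have h₁ : (1 - a) * (T - t) ≤ (1 - a) * (T - τ) := mul_le_mul_of_nonneg_left (by linarith) h1a.le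
        have h₂ : τ + a * (T - τ) = T - (1 - a) * (T - τ) := by ring
        linarith
    simp [indicator_of_notMem hK]

/-- Step A4: the tail `∫_{(t, T − (1−a)(T−t)]} dτ/(T−τ) ≤ a/(1−a)`. [folklore] -/
theorem fwd_tail_weight_le {T t a : ℝ} (ρ : ℝ → ℝ≥0∞) (hρ : ∀ σ, ρ σ = ENNReal.ofReal (1 / (T - σ)))
    (htT : t < T) (ha1 : a < 1) :
    ∫⁻ τ in Ioc t (T - (1 - a) * (T - t)), ρ τ ≤ ENNReal.ofReal (a / (1 - a)) := by
  have h1a : 0 < 1 - a := by linarith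
  have hTt : 0 < T - t := sub_pos.2 htT
  have hpos : 0 < (1 - a) * (T - t) := mul_pos h1a hTt
  calc ∫⁻ τ in Ioc t (T - (1 - a) * (T - t)), ρ τ
      ≤ ∫⁻ _ in Ioc t (T - (1 - a) * (T - t)), ENNReal.ofReal (1 / ((1 - a) * (T - t))) := by
        refine setLIntegral_mono' measurableSet_Ioc fun τ hτ => ?_
        rw [hρ]
        exact ENNReal.ofReal_le_ofReal (one_div_le_one_div_of_le hpos (by linarith [hτ.2]))
    _ = ENNReal.ofReal (1 / ((1 - a) * (T - t))) * volume (Ioc t (T - (1 - a) * (T - t))) :=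
        setLIntegral_const _ _
    _ = ENNReal.ofReal (a / (1 - a)) := by
        rw [Real.volume_Ioc, ← ENNReal.ofReal_mul (one_div_pos.2 hpos).le]
        congr 1
        field_simp
        ring

/-- `∫_{t₁}^{t} 1_A(τ)/(T−τ) dτ = (∫⁻_{A ∩ (t₁,t]} ρ).toReal` for measurable `A`, `t₁ ≤ t < T`, `ρ = 1/(T−·)`. [folklore] -/
theorem logWeight_indicator_eq_toReal {T t₁ t : ℝ} {A : Set ℝ} (ρ : ℝ → ℝ≥0∞)
    (hρ : ∀ σ, ρ σ = ENNReal.ofReal (1 / (T - σ))) (hA : MeasurableSet A) (ht₁t : t₁ ≤ t) (htT : t < T) :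
    ∫ τ in t₁..t, A.indicator (fun _ => (1 : ℝ)) τ / (T - τ) = (∫⁻ τ in A ∩ Ioc t₁ t, ρ τ).toReal := by
  rw [intervalIntegral.integral_of_le ht₁t]
  have hnn : 0 ≤ᵐ[volume.restrict (Ioc t₁ t)] fun τ => A.indicator (fun _ => (1 : ℝ)) τ / (T - τ) := by
    refine ae_restrict_of_forall_mem measurableSet_Ioc fun τ hτ => ?_
    have : 0 < T - τ := by linarith [hτ.2]
    exact div_nonneg (Set.indicator_nonneg (fun _ _ => zero_le_one) _) this.le
  have hmeas : Measurable fun τ => A.indicator (fun _ => (1 : ℝ)) τ / (T - τ) :=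
    (measurable_const.indicator hA).div (measurable_const.sub measurable_id)
  rw [integral_eq_lintegral_of_nonneg_ae hnn hmeas.aestronglyMeasurable]
  have hpt : (fun τ => ENNReal.ofReal (A.indicator (fun _ => (1 : ℝ)) τ / (T - τ))) = A.indicator ρ := by
    funext τ
    by_cases h : τ ∈ A
    · rw [indicator_of_mem h, indicator_of_mem h, hρ]
    · rw [indicator_of_notMem h, indicator_of_notMem h, zero_div, ENNReal.ofReal_zero]
  rw [hpt, setLIntegral_indicator hA]

/-- **Step A5: the clean point.**  If `S` is measurable, `t₁ ≤ t < T`, `0 < a ≤ 1/2`, `η > 0` and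
`2·∫_{t₁}^{t} 1_F/(T−τ) + 2 < η·∫_{t₁}^{t} 1_S/(T−τ)`, then some `τ ∈ S` has an `η`-clean forward window:
`|F ∩ [τ, τ + a(T−τ)]| ≤ η·a(T−τ)`. [folklore] -/
theorem exists_clean_point {T t₁ t a η : ℝ} {S F : Set ℝ} (ht₁t : t₁ ≤ t) (htT : t < T)
    (hS : MeasurableSet S) (hF : MeasurableSet F) (ha : 0 < a) (ha2 : a ≤ 1 / 2) (hη : 0 < η)
    (hbig : 2 * (∫ τ in t₁..t, F.indicator (fun _ => (1 : ℝ)) τ / (T - τ)) + 2 <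
      η * (∫ τ in t₁..t, S.indicator (fun _ => (1 : ℝ)) τ / (T - τ))) :
    ∃ τ ∈ S, volume (F ∩ Icc τ (τ + a * (T - τ))) ≤ ENNReal.ofReal (η * (a * (T - τ))) := by
  by_contra hnone
  push Not at hnone
  have ha1 : a < 1 := by linarith
  have h1a : 0 < 1 - a := by linarith
  -- the weight, the relation, the trimmed set
  obtain ⟨ρ, hρ⟩ : ∃ ρ : ℝ → ℝ≥0∞, ∀ σ, ρ σ = ENNReal.ofReal (1 / (T - σ)) := ⟨fun σ => _, fun σ => rfl⟩
  have hρm : Measurable ρ := by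
    rw [show ρ = fun σ => ENNReal.ofReal (1 / (T - σ)) from funext hρ]
    exact ENNReal.measurable_ofReal.comp (measurable_const.div (measurable_const.sub measurable_id))
  have hρtop : ∀ σ, ρ σ ≠ ⊤ := fun σ => by rw [hρ]; exact ENNReal.ofReal_ne_top
  obtain ⟨P, hP⟩ : ∃ P : Set (ℝ × ℝ), ∀ q : ℝ × ℝ, q ∈ P ↔ q.1 ≤ q.2 ∧ q.2 ≤ q.1 + a * (T - q.1) :=
    ⟨{q | q.1 ≤ q.2 ∧ q.2 ≤ q.1 + a * (T - q.1)}, fun q => Iff.rfl⟩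
  have hPm : MeasurableSet P := by
    rw [show P = {q : ℝ × ℝ | q.1 ≤ q.2 ∧ q.2 ≤ q.1 + a * (T - q.1)} from Set.ext fun q => hP q]
    exact measurableSet_fwdRel T a
  have hS'm : MeasurableSet (S ∩ Ioc t₁ t) := hS.inter measurableSet_Ioc
  have hS'sub : S ∩ Ioc t₁ t ⊆ Ioc t₁ t := inter_subset_right
  rw [logWeight_indicator_eq_toReal ρ hρ hS ht₁t htT, logWeight_indicator_eq_toReal ρ hρ hF ht₁t htT] at hbig
  -- the kernel
  have hf : Measurable (Function.uncurry fun τ t'' : ℝ =>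
      P.indicator (fun _ => (1 : ℝ≥0∞)) (τ, t'') * ρ τ * ρ t'') := by
    have e : (Function.uncurry fun τ t'' : ℝ => P.indicator (fun _ => (1 : ℝ≥0∞)) (τ, t'') * ρ τ * ρ t'') =
        fun q => P.indicator (fun _ => (1 : ℝ≥0∞)) q * ρ q.1 * ρ q.2 := by
      funext q
      rfl
    rw [e]
    exact ((measurable_const.indicator hPm).mul (hρm.comp measurable_fst)).mul (hρm.comp measurable_snd)
  -- (A1) pointwise on the trimmed set
  have hstep1 : ∀ τ ∈ S ∩ Ioc t₁ t, ENNReal.ofReal (η * a) * ρ τ ≤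
      ∫⁻ t'' in F, P.indicator (fun _ => (1 : ℝ≥0∞)) (τ, t'') * ρ τ * ρ t'' := by
    intro τ hτ
    have hτT : τ < T := lt_of_le_of_lt hτ.2.2 htT
    have howned := owned_weight_ge ρ hρ P hP hF hτT ha1 (hnone τ hτ.1).le
    calc ENNReal.ofReal (η * a) * ρ τ
        ≤ (∫⁻ t'' in F, P.indicator (fun _ => (1 : ℝ≥0∞)) (τ, t'') * ρ t'') * ρ τ :=
          mul_le_mul_of_nonneg_right howned bot_le
      _ = ∫⁻ t'' in F, P.indicator (fun _ => (1 : ℝ≥0∞)) (τ, t'') * ρ t'' * ρ τ :=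
          (lintegral_mul_const' _ _ (hρtop τ)).symm
      _ = ∫⁻ t'' in F, P.indicator (fun _ => (1 : ℝ≥0∞)) (τ, t'') * ρ τ * ρ t'' := by
          congr 1
          funext t''
          ring
  -- (A3) pointwise in `t''` after the swap
  have hstep3 : ∀ t'' : ℝ, ∫⁻ τ in S ∩ Ioc t₁ t, P.indicator (fun _ => (1 : ℝ≥0∞)) (τ, t'') * ρ τ * ρ t'' ≤
      (Ioc t₁ (T - (1 - a) * (T - t))).indicator (fun _ => ENNReal.ofReal (a / (1 - a))) t'' * ρ t'' := by
    intro t''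
    rw [lintegral_mul_const' _ _ (hρtop t'')]
    exact mul_le_mul_of_nonneg_right (admissible_weight_le ρ hρ P hP hS'm hS'sub htT ha1) bot_le
  -- (A4) support split
  have hsplit : ∫⁻ t'' in Ioc t₁ (T - (1 - a) * (T - t)) ∩ F, ρ t'' ≤
      (∫⁻ t'' in F ∩ Ioc t₁ t, ρ t'') + ENNReal.ofReal (a / (1 - a)) := by
    calc ∫⁻ t'' in Ioc t₁ (T - (1 - a) * (T - t)) ∩ F, ρ t''
        ≤ ∫⁻ t'' in (F ∩ Ioc t₁ t) ∪ Ioc t (T - (1 - a) * (T - t)), ρ t'' := by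
          refine lintegral_mono_set fun x hx => ?_
          rcases le_or_gt x t with hxt | hxt
          · exact Or.inl ⟨hx.2, hx.1.1, hxt⟩
          · exact Or.inr ⟨hxt, hx.1.2⟩
      _ ≤ (∫⁻ t'' in F ∩ Ioc t₁ t, ρ t'') + ∫⁻ t'' in Ioc t (T - (1 - a) * (T - t)), ρ t'' :=
          lintegral_union_le _ _ _
      _ ≤ (∫⁻ t'' in F ∩ Ioc t₁ t, ρ t'') + ENNReal.ofReal (a / (1 - a)) := by
          gcongr
          exact fwd_tail_weight_le ρ hρ htT ha1
  -- the main inequality in `ℝ≥0∞`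
  have hmain : ENNReal.ofReal (η * a) * ∫⁻ τ in S ∩ Ioc t₁ t, ρ τ ≤
      ENNReal.ofReal (a / (1 - a)) * ((∫⁻ t'' in F ∩ Ioc t₁ t, ρ t'') + ENNReal.ofReal (a / (1 - a))) := by
    calc ENNReal.ofReal (η * a) * ∫⁻ τ in S ∩ Ioc t₁ t, ρ τ
        = ∫⁻ τ in S ∩ Ioc t₁ t, ENNReal.ofReal (η * a) * ρ τ :=
          (lintegral_const_mul' _ _ ENNReal.ofReal_ne_top).symm
      _ ≤ ∫⁻ τ in S ∩ Ioc t₁ t, ∫⁻ t'' in F, P.indicator (fun _ => (1 : ℝ≥0∞)) (τ, t'') * ρ τ * ρ t'' :=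
          setLIntegral_mono' hS'm hstep1
      _ = ∫⁻ t'' in F, ∫⁻ τ in S ∩ Ioc t₁ t, P.indicator (fun _ => (1 : ℝ≥0∞)) (τ, t'') * ρ τ * ρ t'' :=
          lintegral_lintegral_swap hf.aemeasurable
      _ ≤ ∫⁻ t'' in F, (Ioc t₁ (T - (1 - a) * (T - t))).indicator
            (fun _ => ENNReal.ofReal (a / (1 - a))) t'' * ρ t'' :=
          lintegral_mono hstep3
      _ = ∫⁻ t'' in F, (Ioc t₁ (T - (1 - a) * (T - t))).indicator
            (fun σ => ENNReal.ofReal (a / (1 - a)) * ρ σ) t'' := by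
          congr 1
          funext t''
          by_cases h : t'' ∈ Ioc t₁ (T - (1 - a) * (T - t))
          · rw [indicator_of_mem h, indicator_of_mem h]
          · rw [indicator_of_notMem h, indicator_of_notMem h, zero_mul]
      _ = ENNReal.ofReal (a / (1 - a)) * ∫⁻ t'' in Ioc t₁ (T - (1 - a) * (T - t)) ∩ F, ρ t'' := by
          rw [setLIntegral_indicator measurableSet_Ioc, lintegral_const_mul' _ _ ENNReal.ofReal_ne_top]
      _ ≤ ENNReal.ofReal (a / (1 - a)) * ((∫⁻ t'' in F ∩ Ioc t₁ t, ρ t'') + ENNReal.ofReal (a / (1 - a))) :=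
          mul_le_mul_of_nonneg_left hsplit bot_le
  -- finiteness
  have hfinF : (∫⁻ t'' in F ∩ Ioc t₁ t, ρ t'') ≠ ⊤ := by
    have hTt : 0 < T - t := sub_pos.2 htT
    refine ne_top_of_le_ne_top (b := ENNReal.ofReal (1 / (T - t)) * volume (Ioc t₁ t))
      (ENNReal.mul_ne_top ENNReal.ofReal_ne_top (by rw [Real.volume_Ioc]; exact ENNReal.ofReal_ne_top)) ?_
    calc ∫⁻ t'' in F ∩ Ioc t₁ t, ρ t'' ≤ ∫⁻ t'' in Ioc t₁ t, ρ t'' := lintegral_mono_set inter_subset_right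
      _ ≤ ∫⁻ _ in Ioc t₁ t, ENNReal.ofReal (1 / (T - t)) := by
          refine setLIntegral_mono' measurableSet_Ioc fun τ hτ => ?_
          rw [hρ]
          exact ENNReal.ofReal_le_ofReal (one_div_le_one_div_of_le hTt (by linarith [hτ.2]))
      _ = ENNReal.ofReal (1 / (T - t)) * volume (Ioc t₁ t) := setLIntegral_const _ _
  have hq0 : 0 ≤ a / (1 - a) := div_nonneg ha.le h1a.le
  have hfinR : ENNReal.ofReal (a / (1 - a)) *
      ((∫⁻ t'' in F ∩ Ioc t₁ t, ρ t'') + ENNReal.ofReal (a / (1 - a))) ≠ ⊤ :=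
    ENNReal.mul_ne_top ENNReal.ofReal_ne_top (ENNReal.add_ne_top.2 ⟨hfinF, ENNReal.ofReal_ne_top⟩)
  -- back to `ℝ`
  have hreal := ENNReal.toReal_mono hfinR hmain
  rw [ENNReal.toReal_mul, ENNReal.toReal_ofReal (mul_pos hη ha).le, ENNReal.toReal_mul, ENNReal.toReal_ofReal hq0,
    ENNReal.toReal_add hfinF ENNReal.ofReal_ne_top, ENNReal.toReal_ofReal hq0] at hreal
  set LS : ℝ := (∫⁻ τ in S ∩ Ioc t₁ t, ρ τ).toReal with hLS
  set LF : ℝ := (∫⁻ t'' in F ∩ Ioc t₁ t, ρ t'').toReal with hLF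
  have hLF0 : 0 ≤ LF := ENNReal.toReal_nonneg
  have hq1 : a / (1 - a) ≤ 1 := by
    rw [div_le_one h1a]
    linarith
  have hr2 : 1 / (1 - a) ≤ 2 := by
    rw [div_le_iff₀ h1a]
    linarith
  -- `η·LS ≤ (1/(1−a))·(LF + a/(1−a)) ≤ 2·(LF + 1)`
  have hdiv : η * LS ≤ 1 / (1 - a) * (LF + a / (1 - a)) := by
    have e : a / (1 - a) * (LF + a / (1 - a)) = a * (1 / (1 - a) * (LF + a / (1 - a))) := by ring
    have h2 : a * (η * LS) ≤ a * (1 / (1 - a) * (LF + a / (1 - a))) := by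
      calc a * (η * LS) = η * a * LS := by ring
        _ ≤ a / (1 - a) * (LF + a / (1 - a)) := hreal
        _ = a * (1 / (1 - a) * (LF + a / (1 - a))) := e
    exact le_of_mul_le_mul_left h2 ha
  have hfin : η * LS ≤ 2 * LF + 2 := by
    have h3 : 1 / (1 - a) * (LF + a / (1 - a)) ≤ 2 * (LF + 1) :=
      mul_le_mul hr2 (by linarith) (by linarith) (by norm_num)
    linarith
  linarith

/-! ### A calculus fact about the weight `1/(T−τ)` -/

/-- `∫_{t₁}^{t} dτ/(T−τ) = log((T−t₁)/(T−t))` for `t₁ ≤ t < T`. [folklore] -/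
theorem integral_one_div_sub_eq_log {T t₁ t : ℝ} (ht₁t : t₁ ≤ t) (htT : t < T) :
    ∫ τ in t₁..t, (1 : ℝ) / (T - τ) = Real.log ((T - t₁) / (T - t)) := by
  have h := intervalIntegral.integral_comp_sub_left (fun x : ℝ => (1 : ℝ) / x) T (a := t₁) (b := t)
  rw [h, integral_one_div_of_pos (sub_pos.2 htT) (by linarith)]

end Summit.NavierStokesRegularity.NavierStokesRegularity.Theorems.NearExtremalTransiencePerFlow.DepletedFraction

end
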